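import Literature.Analysis.FluidPDE.Tao2016AveragedNS.SplitCascadeReduction
import Literature.Analysis.FluidPDE.TaoCascadeShellDatum
import Literature.Analysis.FluidPDE.TaoCascadeMotion
import HarnessLib

/-!
# Tao's cascade ODE with the squared modes doubled, IV: blow-up of the split local cascade
# equation from "no global solution of the split system" — Theorem 3.3♯ ⇐ Theorem 6.2♯

T. Tao, *Finite time blowup for an averaged three-dimensional Navier–Stokes equation*, J. Amer.
Math. Soc. **29** (2016) 601–674 = arXiv:1402.0290v3, §4, pp. 21–23: Lemma 4.1 (equations of
motion), Theorem 4.2 (ODE blow-up), and "Theorem 3.3 now follows from the following ODE result";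
§6.1, p. 31 [`Tao2016AveragedNS`]. Split companion of the tree's
`Tao2016.localCascade_blowup_of_noGlobalODESolution` (`TaoCascadeEquationsOfMotion.lean`).

HONEST FRAMING (cell harvest/h2-tao-ladder, rung 1 of a ladder of MODEL equations; RUNG1-HANDOFF
h4 / R1-b = the dynamics half of rung 1): this file closes, at the level of Tao's class of LOCAL
CASCADE EQUATIONS `∂ₜu = Δu + C(u,u)` (Definition 3.1), the reduction of the cell's rung-1 dynamics
claim to ONE ODE statement. PROVED here: (i) Lemma 4.1 for a datum supported on one shell,
assembled (`ShellDatum.cascadeODESolutionFrom_of_mild`, from `TaoCascadeShellDatum.lean` and the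
tree's ODE-level Gronwall lemma for (4.13)); (ii) for EVERY wavelet data `𝒟` with seven profiles,
the cascade operator with the cell's square-free table `splitCoeff ε₀ K ε` is a symmetric local
cascade operator with the cancellation property, the two-wavelet datum
`u₀ = (ψ_{0,n₀} + ψ_{1,n₀})/√2` is a Schwartz divergence-free field, and — GIVEN the split analogue
of Theorem 6.2 ("no global solution of `SplitODESystem`", written out as a hypothesis, NOT proved
anywhere) — the initial value problem has no global mild solution for suitable `K, ε, n₀`
(`splitLocalCascade_blowup_of_noGlobalSplit`); in particular the split Theorem 6.2 would also give
Tao's Theorem 3.3 with a SQUARE-FREE witness (`localCascade_blowup_of_noGlobalSplit`). What is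
NOT here: the split Theorem 6.2 itself (the cell's open obligation, `SplitCascadeBlowupDynamics.lean`),
the representation of the split operator as a dilation-free averaged Euler operator (the cell's
"R1-a"), and anything about Navier–Stokes.
-/

noncomputable section

open MeasureTheory Set Filter Finset
open scoped SchwartzMap

namespace Literature.Analysis.FluidPDE

/-! ### (4.13) for a shell-supported datum: the smart constructor -/

namespace TaoCascade

/-- **Smart constructor for the shell-datum format of Lemma 4.1's conclusions**: the fields
(4.5)–(4.10) of `CascadeODESolutionFrom` together with the cancellation (4.3) and `ε₀ > 0` give
(4.11) — no energy ever reaches the shells `n < n₀` — by the tree's ODE-level Gronwall argument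
`eq_zero_of_lt_of_energy` (the datum `∑ᵢ X₀ᵢψ_{i,n₀}` has no energy below `n₀`).
[cite: Tao2016AveragedNS, §4 Lemma 4.1 (4.13)] -/
theorem CascadeODESolutionFrom.of_cancelling {ε₀ : ℝ} (hε : 0 < ε₀) {m : ℕ}
    {α : Fin m → Fin m → Fin m → ℤ × ℤ × ℤ → ℝ} (hα : IsCancellingCoeff α) {K₁ K₂ : ℝ} {n₀ : ℤ}
    {X₀ : Fin m → ℝ} {X E : Fin m → ℤ → ℝ → ℝ}
    (contDiffOn_X : ∀ i n, ContDiffOn ℝ 1 (X i n) (Ici 0))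
    (contDiffOn_E : ∀ i n, ContDiffOn ℝ 1 (E i n) (Ici 0))
    (nonneg_E : ∀ i n t, 0 ≤ t → 0 ≤ E i n t)
    (apriori_X : ∀ T : ℝ, 0 < T → ∃ M : ℝ, ∀ t ∈ Icc 0 T, ∀ (i : Fin m) (n : ℤ),
      (1 + (1 + ε₀) ^ ((10 : ℝ) * n)) * |X i n t| ≤ M)
    (apriori_E : ∀ T : ℝ, 0 < T → ∃ M : ℝ, ∀ t ∈ Icc 0 T, ∀ (i : Fin m) (n : ℤ),
      (1 + (1 + ε₀) ^ ((10 : ℝ) * n)) * Real.sqrt (E i n t) ≤ M)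
    (init_E : ∀ i n, E i n 0 = (1 / 2) * X i n 0 ^ 2)
    (init_X : ∀ i n, X i n 0 = if n = n₀ then X₀ i else 0)
    (motion : ∀ i n t, 0 ≤ t →
      |derivWithin (X i n) (Ici 0) t - quadTerm ε₀ α X i n t| ≤
        K₁ * (1 + ε₀) ^ ((2 : ℝ) * n) * Real.sqrt (E i n t))
    (energy : ∀ i n t, 0 ≤ t → derivWithin (E i n) (Ici 0) t ≤ quadTerm ε₀ α X i n t * X i n t)
    (defect_lower : ∀ i n t, 0 ≤ t → (1 / 2) * X i n t ^ 2 ≤ E i n t)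
    (defect_upper : ∀ i n t, 0 ≤ t →
      E i n t ≤ (1 / 2) * X i n t ^ 2 + K₂ * (1 + ε₀) ^ ((2 : ℝ) * n) * ∫ s in (0 : ℝ)..t, E i n s) :
    CascadeODESolutionFrom ε₀ α K₁ K₂ n₀ X₀ X E := by
  have hbddX : ∀ T : ℝ, 0 < T → ∃ M : ℝ, ∀ t ∈ Icc 0 T, ∀ i n, |X i n t| ≤ M := by
    intro T hT
    obtain ⟨M, hM⟩ := apriori_X T hT
    refine ⟨M, fun t ht i n => ?_⟩
    have h := hM t ht i n
    have hc : (0 : ℝ) ≤ (1 + ε₀) ^ ((10 : ℝ) * n) := (Real.rpow_pos_of_pos (by linarith) _).le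
    nlinarith [abs_nonneg (X i n t)]
  have hinit : ∀ i n, n < n₀ → E i n 0 = 0 := by
    intro i n hn
    rw [init_E, init_X, if_neg hn.ne]
    norm_num
  have hlow := eq_zero_of_lt_of_energy hε hα contDiffOn_E nonneg_E hbddX hinit energy defect_lower
  exact ⟨contDiffOn_X, contDiffOn_E, nonneg_E, apriori_X, apriori_E, init_E, init_X, motion, energy,
    defect_lower, defect_upper, fun i n t hn ht => (hlow i n t hn ht).1,
    fun i n t hn ht => (hlow i n t hn ht).2⟩

end TaoCascade

namespace Tao2016

/-! ### Lemma 4.1 for a shell-supported datum, assembled -/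

/-- **Tao's Lemma 4.1 (equations of motion) for the shell datum `u₀ = ∑ᵢ X₀ᵢ ψ_{i,n₀}` (PROVED).**
For `ε₀ > 0`, wavelet data `𝒟`, structure constants `α` obeying the cancellation (4.3) and any
real amplitudes `X₀`: every global mild solution `u` of `∂ₜu = Δu + C(u,u)`, `u(0) = u₀`, has
coefficients `X_{i,n} = ⟨u, ψ_{i,n}⟩` and local energies `E_{i,n} = ½‖u_{i,n}‖²` obeying
(4.5)–(4.11) in the format `TaoCascade.CascadeODESolutionFrom … X₀`, with the tree's implied
constants `K₁ = 4√2π²(1+ε₀/2)²`, `K₂ = 8π²(1+ε₀/2)²`. [cite: Tao2016AveragedNS, Lemma 4.1] -/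
theorem ShellDatum.cascadeODESolutionFrom_of_mild {ε₀ : ℝ} (hε : 0 < ε₀) {m : ℕ}
    (𝒟 : CascadeWaveletData ε₀ m) {α : Fin m → Fin m → Fin m → ℤ × ℤ × ℤ → ℝ}
    (hcanc : TaoCascade.IsCancellingCoeff α) (X₀ : Fin m → ℝ) (n₀ : ℤ) {u : ℝ → L2C}
    (hu : IsMildSolutionFor (cascadeOperatorForm ε₀ 𝒟.ψ α) (ShellDatum.shellDatum 𝒟 X₀ n₀) (Ici 0) u) :
    TaoCascade.CascadeODESolutionFrom ε₀ α (4 * Real.sqrt 2 * Real.pi ^ 2 * (1 + ε₀ / 2) ^ 2)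
      (8 * Real.pi ^ 2 * (1 + ε₀ / 2) ^ 2) n₀ X₀ (modeCoeff 𝒟 u) (modeEnergy 𝒟 u) :=
  TaoCascade.CascadeODESolutionFrom.of_cancelling hε hcanc
    (fun i n => ShellDatum.contDiffOn_modeCoeff_of_mild (X₀ := X₀) (n₀ := n₀) (i := i) (n := n) hε hu)
    (fun i n => ShellDatum.contDiffOn_modeEnergy_of_mild (X₀ := X₀) (n₀ := n₀) (i := i) (n := n) hε hu)
    (fun i n t _ => modeEnergy_nonneg 𝒟 u i n t)
    (fun T _ => (apriori_of_mild hε hu T).1)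
    (fun T _ => (apriori_of_mild hε hu T).2)
    (fun i n => (ShellDatum.init_of_mild (i := i) (n := n) hε hu).2)
    (fun i n => (ShellDatum.init_of_mild (i := i) (n := n) hε hu).1)
    (fun i n _ ht => ShellDatum.motion_of_mild (i := i) (n := n) hε hu ht)
    (fun i n _ ht => ShellDatum.energy_ineq_of_mild (X₀ := X₀) (n₀ := n₀) (i := i) (n := n) hε hu ht)
    (fun i n _ ht => ShellDatum.defect_lower_of_mild (X₀ := X₀) (n₀ := n₀) (i := i) (n := n) hε hu ht)
    (fun i n _ ht => ShellDatum.defect_upper_of_mild (i := i) (n := n) hε hu ht)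

/-! ### The two-wavelet split datum as a Schwartz field -/

section SchwartzDatum

variable {ε₀ : ℝ}

/-- `L²` classes of real Schwartz fields add. [folklore] -/
private theorem schwartzL2_add (f g : 𝓢(EuclideanSpace ℝ (Fin 3), EuclideanSpace ℝ (Fin 3))) :
    schwartzL2 (f + g) = schwartzL2 f + schwartzL2 g := by
  rw [schwartzL2_eq_toLp, schwartzL2_eq_toLp, schwartzL2_eq_toLp, schwartzC, map_add,
    ← SchwartzMap.toLpCLM_apply (𝕜 := ℝ), map_add, SchwartzMap.toLpCLM_apply,
    SchwartzMap.toLpCLM_apply]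
  rfl

/-- The sum of two divergence-free Schwartz fields is divergence free. [folklore] -/
private theorem isDivFree_add_schwartz {f g : 𝓢(EuclideanSpace ℝ (Fin 3), EuclideanSpace ℝ (Fin 3))} (hf : VectorCalculus.IsDivFree ⇑f)
    (hg : VectorCalculus.IsDivFree ⇑g) : VectorCalculus.IsDivFree ⇑(f + g) := by
  intro x
  have h1 := hf x
  have h2 := hg x
  unfold VectorCalculus.divergence at h1 h2 ⊢
  rw [show ⇑(f + g) = ⇑f + ⇑g from rfl, fderiv_add (f.differentiableAt) (g.differentiableAt)]
  simp [h1, h2]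

/-- A scalar multiple of a divergence-free Schwartz field is divergence free. [folklore] -/
private theorem isDivFree_smul_schwartz (c : ℝ) {f : 𝓢(EuclideanSpace ℝ (Fin 3), EuclideanSpace ℝ (Fin 3))} (hf : VectorCalculus.IsDivFree ⇑f) :
    VectorCalculus.IsDivFree ⇑(c • f) := by
  intro x
  have h1 := hf x
  unfold VectorCalculus.divergence at h1 ⊢
  rw [show ⇑(c • f) = c • ⇑f from rfl, fderiv_const_smul (f.differentiableAt)]
  simp [h1]

/-- **The split datum as a Schwartz field**: `u₀ = (√2/2)(ψ_{0,n₀} + ψ_{1,n₀})` — both copies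
`a′, a″` (modes `0, 1`) of the input mode of shell `n₀`, loaded equally.
[cite: Tao2016AveragedNS, §4 (4.4)] -/
def splitSchwartzDatum (hε₀ : 0 < ε₀) (𝒟 : CascadeWaveletData ε₀ 7) (n₀ : ℤ) :
    𝓢(EuclideanSpace ℝ (Fin 3), EuclideanSpace ℝ (Fin 3)) :=
  (Real.sqrt 2 / 2) • (schwartzWavelet (lt_trans hε₀ (by linarith) : 0 < 1 + ε₀) (𝒟.ψ 0) n₀ +
    schwartzWavelet (lt_trans hε₀ (by linarith) : 0 < 1 + ε₀) (𝒟.ψ 1) n₀)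

/-- The split Schwartz datum is divergence free. [cite: Tao2016AveragedNS, §4 (4.4)] -/
theorem isDivFree_splitSchwartzDatum (hε₀ : 0 < ε₀) (𝒟 : CascadeWaveletData ε₀ 7) (n₀ : ℤ) :
    VectorCalculus.IsDivFree ⇑(splitSchwartzDatum hε₀ 𝒟 n₀) :=
  isDivFree_smul_schwartz _ (isDivFree_add_schwartz
    (isDivFree_schwartzWavelet _ (𝒟.isDivFree 0) n₀) (isDivFree_schwartzWavelet _ (𝒟.isDivFree 1) n₀))

/-- **The `L²` class of the split Schwartz datum is the shell datum with amplitudes `splitDatum`**: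
`schwartzL2 u₀ = ∑ᵢ (splitDatum i) ψ_{i,n₀}`. [cite: Tao2016AveragedNS, §4 (4.4)] -/
theorem schwartzL2_splitSchwartzDatum (hε₀ : 0 < ε₀) (𝒟 : CascadeWaveletData ε₀ 7) (n₀ : ℤ) :
    schwartzL2 (splitSchwartzDatum hε₀ 𝒟 n₀) =
      ShellDatum.shellDatum 𝒟 Tao2016AveragedNS.splitDatum n₀ := by
  rw [splitSchwartzDatum, schwartzL2_smul, schwartzL2_add, schwartzL2_schwartzWavelet,
    schwartzL2_schwartzWavelet, ShellDatum.shellDatum, Fin.sum_univ_seven]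
  simp [Tao2016AveragedNS.splitDatum, smul_add]

end SchwartzDatum

/-! ### Theorem 3.3♯ from Theorem 6.2♯ -/

/-- **Blow-up of the split local cascade equation from "no global solution of the split system"
(PROVED reduction; the hypothesis — the split analogue of Theorem 6.2 — is written out and NOT
asserted).** For every `0 < ε₀ < 1` there are `K > 0`, `ε > 0` such that the square-free split table
`α♯ = splitCoeff ε₀ K ε` has the following property: for EVERY seven-profile wavelet data `𝒟`, the
cascade operator `C♯ = cascadeOperatorForm ε₀ 𝒟.ψ α♯` is a symmetric local cascade operator with
the cancellation property (3.2), and for all sufficiently large `n₀` the Schwartz divergence-free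
datum `u₀ = (ψ_{0,n₀} + ψ_{1,n₀})/√2` admits no global mild solution of `∂ₜu = Δu + C♯(u,u)`.
Chain: Lemma 4.1 for the shell datum (`ShellDatum.cascadeODESolutionFrom_of_mild`) ⇒ split system
(`CascadeODESolutionFrom.toSplitODESystem`) ⇒ excluded by the hypothesis.
[cite: Tao2016AveragedNS, §4 pp. 21–23] -/
theorem splitLocalCascade_blowup_of_noGlobalSplit
    (h62 : ∀ ε₀ : ℝ, 0 < ε₀ → ε₀ < 1 →
      ∃ K₀ : ℝ, ∀ K : ℝ, K₀ ≤ K → 0 < K →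
        ∃ e₀ : ℝ, 0 < e₀ ∧ ∀ ε : ℝ, 0 < ε → ε ≤ e₀ →
          ∀ C₁ C₂ : ℝ, 0 ≤ C₁ → 0 ≤ C₂ →
            ∃ N₀ : ℤ, ∀ n₀ : ℤ, N₀ ≤ n₀ →
              ¬ ∃ (S : Fin 4 → ℤ → ℝ → ℝ) (Z : Fin 3 → ℤ → ℝ → ℝ) (E : ℤ → ℝ → ℝ),
                Tao2016AveragedNS.SplitODESystem ε₀ K ε C₁ C₂ n₀ S Z E)
    {ε₀ : ℝ} (hε₀ : 0 < ε₀) (hε₀1 : ε₀ < 1) :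
    ∃ K ε : ℝ, 0 < K ∧ 0 < ε ∧
      TaoCascade.IsSquareFreeCoeff (Tao2016AveragedNS.splitCoeff ε₀ K ε) ∧
      ∀ 𝒟 : CascadeWaveletData ε₀ 7,
        IsLocalCascadeForm ε₀ (cascadeOperatorForm ε₀ 𝒟.ψ (Tao2016AveragedNS.splitCoeff ε₀ K ε)) ∧
        (∀ u v w, cascadeOperatorForm ε₀ 𝒟.ψ (Tao2016AveragedNS.splitCoeff ε₀ K ε) u v w =
          cascadeOperatorForm ε₀ 𝒟.ψ (Tao2016AveragedNS.splitCoeff ε₀ K ε) v u w) ∧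
        (∀ u, cascadeOperatorForm ε₀ 𝒟.ψ (Tao2016AveragedNS.splitCoeff ε₀ K ε) u u u = 0) ∧
        ∃ N₀ : ℤ, ∀ n₀ : ℤ, N₀ ≤ n₀ →
          VectorCalculus.IsDivFree ⇑(splitSchwartzDatum hε₀ 𝒟 n₀) ∧
          ¬ ∃ u : ℝ → L2C,
            IsMildSolutionFor (cascadeOperatorForm ε₀ 𝒟.ψ (Tao2016AveragedNS.splitCoeff ε₀ K ε))
              (schwartzL2 (splitSchwartzDatum hε₀ 𝒟 n₀)) (Ici 0) u := by
  obtain ⟨K, ε, hK, hε, hsymm, hcanc, hsq, h42⟩ :=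
    Tao2016AveragedNS.splitOdeBlowup_of_noGlobalSplit h62 ε₀ hε₀ hε₀1
  refine ⟨K, ε, hK, hε, hsq, fun 𝒟 => ⟨isLocalCascadeForm_cascadeOperatorForm hε₀ hε₀1.le 𝒟 _,
    fun u v w => cascadeOperatorForm_symm ε₀ 𝒟.ψ hsymm u v w,
    fun u => cascadeOperatorForm_cancel ε₀ 𝒟.ψ hcanc u, ?_⟩⟩
  obtain ⟨N₀, hN₀⟩ := h42 (4 * Real.sqrt 2 * Real.pi ^ 2 * (1 + ε₀ / 2) ^ 2)
    (8 * Real.pi ^ 2 * (1 + ε₀ / 2) ^ 2) (by positivity) (by positivity)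
  refine ⟨N₀, fun n₀ hn₀ => ⟨isDivFree_splitSchwartzDatum hε₀ 𝒟 n₀, ?_⟩⟩
  rintro ⟨u, hu⟩
  rw [schwartzL2_splitSchwartzDatum] at hu
  exact hN₀ n₀ hn₀ ⟨_, _, ShellDatum.cascadeODESolutionFrom_of_mild hε₀ 𝒟 hcanc _ n₀ hu⟩

/-- **Tao's Theorem 3.3 would also follow from the split Theorem 6.2, with a SQUARE-FREE witness**
(PROVED reduction): the hypothesis as in `splitLocalCascade_blowup_of_noGlobalSplit`; the
conclusion is the tree's `localCascade_blowup` (Theorem 3.3 as printed), realised by the split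
cascade operator on any seven-profile wavelet data (`nonempty_cascadeWaveletData`) and the
two-wavelet datum. [cite: Tao2016AveragedNS, Thm. 3.3] -/
theorem localCascade_blowup_of_noGlobalSplit
    (h62 : ∀ ε₀ : ℝ, 0 < ε₀ → ε₀ < 1 →
      ∃ K₀ : ℝ, ∀ K : ℝ, K₀ ≤ K → 0 < K →
        ∃ e₀ : ℝ, 0 < e₀ ∧ ∀ ε : ℝ, 0 < ε → ε ≤ e₀ →
          ∀ C₁ C₂ : ℝ, 0 ≤ C₁ → 0 ≤ C₂ →
            ∃ N₀ : ℤ, ∀ n₀ : ℤ, N₀ ≤ n₀ →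
              ¬ ∃ (S : Fin 4 → ℤ → ℝ → ℝ) (Z : Fin 3 → ℤ → ℝ → ℝ) (E : ℤ → ℝ → ℝ),
                Tao2016AveragedNS.SplitODESystem ε₀ K ε C₁ C₂ n₀ S Z E) :
    localCascade_blowup := by
  intro ε₀ hε₀ hε₀1
  obtain ⟨𝒟⟩ := nonempty_cascadeWaveletData hε₀ 7
  obtain ⟨K, ε, -, -, -, h⟩ := splitLocalCascade_blowup_of_noGlobalSplit h62 hε₀ hε₀1
  obtain ⟨hform, hsymm, hcanc, N₀, hN₀⟩ := h 𝒟
  obtain ⟨hdiv, hno⟩ := hN₀ N₀ le_rfl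
  exact ⟨_, hform, fun u v w _ _ _ => hsymm u v w, fun u _ => hcanc u, _, hdiv, hno⟩

end Tao2016

end Literature.Analysis.FluidPDE
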